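/-
Copyright (c) 2026 the pub-hodgecm-mathlib formalisation cell (harness21).  Prover seat hodgecm-mathlib-B-p08 (g41): req618 STAGE 1a «FOUR-FRAME» squad
(director s1808; heir LEAD F0P3a-plan (g18) DIRECTIVE b9ecbbedecc9c5ae D3 day 1 ∕ D7 «B-p08 — A-1 port (incl. `rank_two_shape`)»; dealer LH4-plan (g10) WORD #1 deal g10-#4);
2026-09-03.  PORT (FILE 1 of 2) of the HOME proof cert `F0/P3a/F0P3a-p01/g30/CERT-A1-DefectModuleShape.v1.F0P3ap01g30.lean` §P3 (sha16 abad451e204113eb, author F0P3a-p01 (g30)).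
-/
import Literature.NumberTheory.Automorphic.SymplecticGroupCartanUnique   -- ★ `CartanUnique.uniformizer_ne_zero`, `v_uniformizer_pow`, `exists_v_eq_exp_neg` (the `ℤᵐ⁰`-valued DVR kit)
import HarnessLib

/-!
# The rank-two shape lemma: an `𝒪`-submodule of `𝒪 × 𝒪` is `𝒪(ϖ^{c₁}, 0) + 𝒪(0, ϖ^{c₂}) + 𝒪(ϖ^{c₁−k}u, ϖ^{c₂−k})`
# («(D-RAM) FOUR-FRAME» road, unit (i) item A-1, the module-algebra core `rank_two_shape`)

Topic `NumberTheory/Automorphic`; namespace `Literature.NumberTheory.Automorphic.UnitaryThreeFourFrame` (the vocabulary namespace of the road, dealer LH4-plan (g10)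
WORD #1 g10-#0 «DEFS-1»).  THEOREMS ONLY (no `def`, no instance, no notation, no named fact, no `sorry`); kernel lane `--supports stmt-HodgeConjecture-24833`.
Cell `pub/hodgecm-mathlib` (D-0151), crux H413 = `stmt-HodgeConjecture-24833`, route `HCCMUnconditional`; in-house road «(D-RAM) FOUR-FRAME» under the leaf stub
`stub_DyRamCore` (`Cruxes/H413/Lines/F0_P3c_DyadicPaydown.lean` ED. 4 :147), STAGE 1a (director s1808; heir LEAD F0P3a-plan (g18) DIRECTIVE
`F0/P3a/F0P3a-plan/g18/STAGE1a-DIRECTIVE-DRAM-FourFrame.v1.F0P3a-plan-g18.md` b9ecbbedecc9c5ae D3 day 1 «PORT the three HOME certs to tree support files», D7 «B-p08 — A-1 port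
(incl. `rank_two_shape`)»).  FILE 1 of the A-1 port = §P3 of the HOME cert `F0/P3a/F0P3a-p01/g30/CERT-A1-DefectModuleShape.v1.F0P3ap01g30.lean` (abad451e204113eb, author
F0P3a-p01 (g30), rc 0 ∕ 0 ∕ 0 ∕ 0, axioms trio), proof VERBATIM; FILE 2 `UnitaryThreeFourFrameDefectModuleShape` (the defect module of a lattice in a frame, head A-1) imports it.
The split is forced by the 400-line rule only.

THE MATHEMATICS.  `K` a field with `Valued K ℤᵐ⁰`, `𝒪 = 𝒪[K]`, `ϖ` a uniformiser (`|ϖ| = exp(−1)`).  **`rank_two_shape`**: let `M ⊆ K × K` be an `𝒪`-submodule contained in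
`𝒪 × 𝒪` whose two AXES are non-trivial, `c₁` the LEAST `c` with `(ϖ^c, 0) ∈ M` and `c₂` the least `c` with `(0, ϖ^c) ∈ M`.  Then for some `k ≤ min(c₁, c₂)` and some unit `u`
`M = 𝒪(ϖ^{c₁}, 0) + 𝒪(0, ϖ^{c₂}) + 𝒪(ϖ^{c₁−k}u, ϖ^{c₂−k})`.
This is the elementary-divisor ∕ stacked-basis theorem for a submodule of `𝒪²` (Lang, *Algebra* III §7 Thm. 7.8) in the explicit «two axes + one glued generator» form the
four-frame census reads (memo v1.4 §2 (A): `M_Λ = 𝔭^{c₁} ⊕ 𝔭^{c₂} + 𝒪·(ϖ^{c₁−k}u_Λ, ϖ^{c₂−k})`, `u_Λ` the gluing unit, determined mod `𝔭^k`).  PROOF (cert §P3): the axes of `M`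
are exactly `𝔭^{c₁} × 0` and `0 × 𝔭^{c₂}` (divide by units); let `j₁` be the least first-coordinate depth in `M`, attained at `p₀ = (x₀, y₀)`, and `k := c₁ − j₁`; if `k = 0` the
module is the sum of its axes (`u = 1`); if `k ≥ 1` two exchange arguments — `(ϖ^k x₀, 0) ∈ M` forces `(0, ϖ^k y₀) ∈ M` so `|ϖ^k y₀| ≤ exp(−c₂)`, while `|ϖ^{k−1} y₀| ≤ exp(−c₂)`
would put `(ϖ^{k−1}x₀, 0)` in `M`, contradicting the minimality of `c₁` — pin `|y₀| = exp(−(c₂−k))` exactly, whence `k ≤ c₂` and the generator `p* = (y₀∕ϖ^{c₂−k})⁻¹·p₀ =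
(ϖ^{c₁−k}u, ϖ^{c₂−k})`; finally every `p ∈ M` is `r·p* + s·(0, ϖ^{c₂})` (first coordinates have depth `≥ j₁`).
* §1 `exists_mul_of_v_le` (`|x| ≤ |y| ≠ 0 ⇒ x = r·y`, `r ∈ 𝒪`; the other DVR bookkeeping is ★ `CartanUnique.uniformizer_ne_zero ∕ v_uniformizer_pow ∕ exists_v_eq_exp_neg`).
* §2 **`rank_two_shape`**.
HONEST LABEL: HC_CM is proved only modulo the 7 printed citations (2 remaining named inputs: hLiu418 = stmt-HodgeConjecture-24832, h413 = stmt-HodgeConjecture-24833) until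
rung 0 closes; this file is count-neutral (module algebra for unit (i) of an in-house road; it pays no organ and moves no verdict; the road is registry-moving only on completion).

## References
* [Lang2002] S. Lang, *Algebra*, rev. 3rd ed., GTM 211 (2002), Ch. III §7, Thm. 7.8 (elementary divisors: a submodule of a finite free module over a principal ring has a
  stacked basis `a₁e₁, …, a_re_r`).
* [Serre1979] J.-P. Serre, *Local Fields*, GTM 67 (1979), Ch. I §1 (discrete valuation rings: `x = ϖ^n u`, divisibility = comparison of valuations).
-/

set_option autoImplicit false

noncomputable section

open scoped Valued WithZero

namespace Literature.NumberTheory.Automorphic.UnitaryThreeFourFrame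

open Literature.NumberTheory.Automorphic.CartanUnique

variable {K : Type*} [Field K] [Valued K ℤᵐ⁰]

/-! ## §1  Divisibility in `𝒪` from valuations -/

/-- `|x| ≤ |y|`, `y ≠ 0` ⇒ `x = r·y` with `r ∈ 𝒪` (`r = x∕y`). [cite: Serre1979, Ch. I §1] -/
theorem exists_mul_of_v_le {x y : K} (hy : y ≠ 0) (h : Valued.v x ≤ Valued.v y) : ∃ r : K, Valued.v r ≤ 1 ∧ x = r * y := by
  refine ⟨x / y, ?_, (div_mul_cancel₀ x hy).symm⟩
  rw [map_div₀]
  exact (div_le_one₀ ((Valuation.pos_iff _).2 hy)).2 h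

/-! ## §2  The rank-two shape lemma -/

/-- **RANK-TWO SHAPE LEMMA.**  Let `M ⊆ K × K` be an `𝒪`-submodule contained in `𝒪 × 𝒪`, and let `c₁`, `c₂` be the LEAST `c : ℕ` with `(ϖ^c, 0) ∈ M`, resp. `(0, ϖ^c) ∈ M`
(`v ϖ = exp(−1)`).  Then there are `k ≤ min(c₁, c₂)` and a unit `u` with `M = 𝒪(ϖ^{c₁}, 0) + 𝒪(0, ϖ^{c₂}) + 𝒪(ϖ^{c₁−k}u, ϖ^{c₂−k})` (as subsets of `K × K`).  Elementary
divisors for a submodule of `𝒪²`, in the explicit «axes + one glued generator» form; HOME cert abad451e204113eb §P3, proof verbatim. [cite: Lang2002, Ch. III §7 Thm. 7.8] -/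
theorem rank_two_shape {ϖ : K} (hϖ : Valued.v ϖ = WithZero.exp (-1 : ℤ)) (M : Submodule 𝒪[K] (K × K))
    (hM : ∀ p ∈ M, Valued.v (p : K × K).1 ≤ 1 ∧ Valued.v (p : K × K).2 ≤ 1) {c₁ c₂ : ℕ}
    (h₁ : IsLeast {c : ℕ | ((ϖ ^ c : K), (0 : K)) ∈ M} c₁) (h₂ : IsLeast {c : ℕ | ((0 : K), (ϖ ^ c : K)) ∈ M} c₂) :
    ∃ (k : ℕ) (u : K), Valued.v u = 1 ∧ k ≤ c₁ ∧ k ≤ c₂ ∧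
      (M : Set (K × K)) = (Submodule.span 𝒪[K] ({((ϖ ^ c₁ : K), (0 : K)), ((0 : K), (ϖ ^ c₂ : K)),
          (ϖ ^ (c₁ - k) * u, ϖ ^ (c₂ - k))} : Set (K × K)) : Set (K × K)) := by
  have hϖ0 : ϖ ≠ 0 := uniformizer_ne_zero hϖ
  have hvpow := v_uniformizer_pow hϖ
  -- scalar action by integral elements, in coordinates
  have hsm : ∀ {w : K}, Valued.v w ≤ 1 → ∀ {p : K × K}, p ∈ M → (w * p.1, w * p.2) ∈ M :=
    fun {w} hw {p} hp => M.smul_mem (⟨w, hw⟩ : 𝒪[K]) hp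
  -- FACT C: the second axis of `M` is `𝔭^{c₂}`
  have hC2 : ∀ {z : K}, ((0 : K), z) ∈ M → ∃ r : K, Valued.v r ≤ 1 ∧ z = r * ϖ ^ c₂ := by
    intro z hz
    by_cases hz0 : z = 0
    · exact ⟨0, by rw [map_zero]; exact zero_le, by rw [hz0, zero_mul]⟩
    obtain ⟨j, hj⟩ := exists_v_eq_exp_neg hz0 (hM _ hz).2
    have hmem : ((0 : K), (ϖ ^ j : K)) ∈ M := by
      have hw : Valued.v (ϖ ^ j / z) ≤ 1 := by
        rw [map_div₀, hvpow, hj, div_self WithZero.exp_ne_zero]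
      have := hsm hw hz
      rwa [mul_zero, div_mul_cancel₀ _ hz0] at this
    have hcj : c₂ ≤ j := h₂.2 hmem
    refine exists_mul_of_v_le (pow_ne_zero _ hϖ0) ?_
    rw [hj, hvpow, WithZero.exp_le_exp]
    omega
  -- FACT C': the first axis of `M` is `𝔭^{c₁}`
  have hC1 : ∀ {z : K}, (z, (0 : K)) ∈ M → ∃ r : K, Valued.v r ≤ 1 ∧ z = r * ϖ ^ c₁ := by
    intro z hz
    by_cases hz0 : z = 0
    · exact ⟨0, by rw [map_zero]; exact zero_le, by rw [hz0, zero_mul]⟩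
    obtain ⟨j, hj⟩ := exists_v_eq_exp_neg hz0 (hM _ hz).1
    have hmem : ((ϖ ^ j : K), (0 : K)) ∈ M := by
      have hw : Valued.v (ϖ ^ j / z) ≤ 1 := by
        rw [map_div₀, hvpow, hj, div_self WithZero.exp_ne_zero]
      have := hsm hw hz
      rwa [mul_zero, div_mul_cancel₀ _ hz0] at this
    have hcj : c₁ ≤ j := h₁.2 hmem
    refine exists_mul_of_v_le (pow_ne_zero _ hϖ0) ?_
    rw [hj, hvpow, WithZero.exp_le_exp]
    omega
  -- `j₁` = the least first-coordinate depth in `M` (it exists: `(ϖ^{c₁}, 0) ∈ M`), attained at `p₀`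
  have hex : ∃ j : ℕ, ∃ p ∈ M, Valued.v (p : K × K).1 = WithZero.exp (-(j : ℤ)) := ⟨c₁, _, h₁.1, hvpow c₁⟩
  classical
  obtain ⟨j₁, ⟨p₀, hp₀, hvp₀⟩, hmin⟩ : ∃ j₁ : ℕ, (∃ p ∈ M, Valued.v (p : K × K).1 = WithZero.exp (-(j₁ : ℤ))) ∧
      ∀ j : ℕ, (∃ p ∈ M, Valued.v (p : K × K).1 = WithZero.exp (-(j : ℤ))) → j₁ ≤ j :=
    ⟨Nat.find hex, Nat.find_spec hex, fun j => Nat.find_min' hex⟩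
  have hj₁c₁ : j₁ ≤ c₁ := hmin c₁ ⟨_, h₁.1, hvpow c₁⟩
  -- FACT A: every first coordinate has valuation `≤ exp(−j₁)`
  have hA : ∀ p ∈ M, Valued.v (p : K × K).1 ≤ WithZero.exp (-(j₁ : ℤ)) := by
    intro p hp
    by_cases hp0 : p.1 = 0
    · rw [hp0, map_zero]; exact zero_le
    obtain ⟨j, hj⟩ := exists_v_eq_exp_neg hp0 (hM p hp).1
    rw [hj, WithZero.exp_le_exp, neg_le_neg_iff, Nat.cast_le]
    exact hmin j ⟨p, hp, hj⟩
  -- THE GENERATOR `p* = (ϖ^{c₁−k}u, ϖ^{c₂−k}) ∈ M` with `c₁ − k = j₁`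
  obtain ⟨k, u, hu, hk₁, hk₂, hkj, hstar⟩ : ∃ (k : ℕ) (u : K), Valued.v u = 1 ∧ k ≤ c₁ ∧ k ≤ c₂ ∧ c₁ - k = j₁ ∧
      (ϖ ^ (c₁ - k) * u, ϖ ^ (c₂ - k)) ∈ M := by
    rcases hj₁c₁.eq_or_lt with hj | hj
    · -- `k = 0`: `M` is the sum of its axes; generator `(ϖ^{c₁}, ϖ^{c₂})`, `u = 1`
      refine ⟨0, 1, map_one _, Nat.zero_le _, Nat.zero_le _, by omega, ?_⟩
      rw [Nat.sub_zero, Nat.sub_zero, mul_one]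
      have := M.add_mem h₁.1 h₂.1
      rwa [Prod.mk_add_mk, add_zero, zero_add] at this
    · -- `k = c₁ − j₁ ≥ 1`: the element `p₀ = (x₀, y₀)` of depth `j₁` has `|y₀| = exp(−(c₂ − k))`
      obtain ⟨k, hk⟩ : ∃ k : ℕ, k = c₁ - j₁ := ⟨_, rfl⟩
      have hk1 : 1 ≤ k := by omega
      have hvϖk : Valued.v (ϖ ^ k) ≤ 1 := by rw [hvpow, ← WithZero.exp_zero, WithZero.exp_le_exp]; omega
      have hvϖk1 : Valued.v (ϖ ^ (k - 1)) ≤ 1 := by rw [hvpow, ← WithZero.exp_zero, WithZero.exp_le_exp]; omega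
      -- (ii) `|ϖ^k y₀| ≤ exp(−c₂)`: `(ϖ^k x₀, 0) ∈ 𝒪(ϖ^{c₁}, 0) ⊆ M`, hence `(0, ϖ^k y₀) ∈ M`
      have hii : Valued.v (ϖ ^ k * p₀.2) ≤ WithZero.exp (-(c₂ : ℤ)) := by
        have ht : Valued.v (ϖ ^ k * p₀.1 / ϖ ^ c₁) ≤ 1 := by
          rw [map_div₀, map_mul, hvpow, hvpow, hvp₀, ← WithZero.exp_add, ← WithZero.exp_sub, ← WithZero.exp_zero, WithZero.exp_le_exp]
          omega
        have h1 : (ϖ ^ k * p₀.1, (0 : K)) ∈ M := by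
          have := hsm ht h₁.1
          rwa [mul_zero, div_mul_cancel₀ _ (pow_ne_zero _ hϖ0)] at this
        have h2 : ((0 : K), ϖ ^ k * p₀.2) ∈ M := by
          have := M.sub_mem (hsm hvϖk hp₀) h1
          rwa [Prod.mk_sub_mk, sub_self, sub_zero] at this
        obtain ⟨r, hr, hr'⟩ := hC2 h2
        rw [hr', map_mul, hvpow]
        exact mul_le_of_le_one_left' hr
      -- (i) `|ϖ^{k−1} y₀| > exp(−c₂)`: otherwise `(0, ϖ^{k−1} y₀) ∈ M`, so `(ϖ^{k−1} x₀, 0) ∈ M ⊆ 𝔭^{c₁} × 0`, depth contradiction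
      have hi : WithZero.exp (-(c₂ : ℤ)) < Valued.v (ϖ ^ (k - 1) * p₀.2) := by
        by_contra hle
        rw [not_lt] at hle
        have h2 : ((0 : K), ϖ ^ (k - 1) * p₀.2) ∈ M := by
          obtain ⟨r, hr, hr'⟩ := exists_mul_of_v_le (pow_ne_zero c₂ hϖ0) (hle.trans (hvpow c₂).ge)
          have := hsm hr h₂.1
          rwa [mul_zero, ← hr'] at this
        have h1 : (ϖ ^ (k - 1) * p₀.1, (0 : K)) ∈ M := by
          have := M.sub_mem (hsm hvϖk1 hp₀) h2
          rwa [Prod.mk_sub_mk, sub_zero, sub_self] at this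
        obtain ⟨r, hr, hr'⟩ := hC1 h1
        have hle' : Valued.v (ϖ ^ (k - 1) * p₀.1) ≤ WithZero.exp (-(c₁ : ℤ)) := by
          rw [hr', map_mul, hvpow]
          exact mul_le_of_le_one_left' hr
        rw [map_mul, hvpow, hvp₀, ← WithZero.exp_add, WithZero.exp_le_exp] at hle'
        omega
      -- hence `y₀ ≠ 0`, `|y₀| = exp(−(c₂ − k))`, `k ≤ c₂`
      have hy0 : p₀.2 ≠ 0 := fun h => by
        rw [h, mul_zero, map_zero] at hi
        exact not_lt.2 zero_le hi
      obtain ⟨m, hm⟩ : ∃ m : ℤ, Valued.v p₀.2 = WithZero.exp m := ⟨_, (WithZero.exp_log ((Valuation.ne_zero_iff _).2 hy0)).symm⟩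
      have hm0 : m ≤ 0 := by
        have := (hM p₀ hp₀).2
        rwa [hm, ← WithZero.exp_zero, WithZero.exp_le_exp] at this
      rw [map_mul, hvpow, hm, ← WithZero.exp_add, WithZero.exp_lt_exp] at hi
      rw [map_mul, hvpow, hm, ← WithZero.exp_add, WithZero.exp_le_exp] at hii
      have hkc₂ : k ≤ c₂ := by omega
      have hmk : m = -((c₂ - k : ℕ) : ℤ) := by omega
      have hx0 : p₀.1 ≠ 0 := fun h => by
        rw [h, map_zero] at hvp₀
        exact WithZero.exp_ne_zero hvp₀.symm
      -- `u₂ = y₀ ∕ ϖ^{c₂−k}` is a unit; `p* = u₂⁻¹ · p₀`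
      have hu₂ : Valued.v (p₀.2 / ϖ ^ (c₂ - k)) = 1 := by
        rw [map_div₀, hm, hvpow, hmk, div_self WithZero.exp_ne_zero]
      have hu₂0 : p₀.2 / ϖ ^ (c₂ - k) ≠ 0 := div_ne_zero hy0 (pow_ne_zero _ hϖ0)
      refine ⟨k, p₀.1 / (p₀.2 / ϖ ^ (c₂ - k)) / ϖ ^ (c₁ - k), ?_, by omega, hkc₂, by omega, ?_⟩
      · rw [map_div₀, map_div₀, hu₂, div_one, hvp₀, hvpow, show c₁ - k = j₁ by omega, div_self WithZero.exp_ne_zero]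
      · have hw : Valued.v (p₀.2 / ϖ ^ (c₂ - k))⁻¹ ≤ 1 := by rw [map_inv₀, hu₂, inv_one]
        have hmem := hsm hw hp₀
        have e1 : (p₀.2 / ϖ ^ (c₂ - k))⁻¹ * p₀.1 = ϖ ^ (c₁ - k) * (p₀.1 / (p₀.2 / ϖ ^ (c₂ - k)) / ϖ ^ (c₁ - k)) := by
          field_simp
        have e2 : (p₀.2 / ϖ ^ (c₂ - k))⁻¹ * p₀.2 = ϖ ^ (c₂ - k) := by
          field_simp
        rwa [e1, e2] at hmem
  -- THE SPAN EQUALITY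
  have hvstar : Valued.v (ϖ ^ (c₁ - k) * u) = WithZero.exp (-(j₁ : ℤ)) := by
    rw [map_mul, hvpow, hu, mul_one, hkj]
  have hstar0 : ϖ ^ (c₁ - k) * u ≠ 0 := fun h => by
    rw [h, map_zero] at hvstar
    exact WithZero.exp_ne_zero hvstar.symm
  refine ⟨k, u, hu, hk₁, hk₂, Set.Subset.antisymm ?_ ?_⟩
  · -- `M ⊆ span`: `p = r·p* + s·(0, ϖ^{c₂})`
    intro p hp
    have hp' : p ∈ M := hp
    obtain ⟨r, hr, hr'⟩ := exists_mul_of_v_le hstar0 ((hA p hp').trans hvstar.ge)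
    have hq : ((0 : K), p.2 - r * ϖ ^ (c₂ - k)) ∈ M := by
      have := M.sub_mem hp' (hsm hr hstar)
      have e : p - (r * (ϖ ^ (c₁ - k) * u), r * ϖ ^ (c₂ - k)) = ((0 : K), p.2 - r * ϖ ^ (c₂ - k)) := by
        ext
        · change p.1 - r * (ϖ ^ (c₁ - k) * u) = 0
          rw [hr', sub_self]
        · rfl
      rwa [e] at this
    obtain ⟨s, hs, hs'⟩ := hC2 hq
    have hp_eq : p = (⟨r, hr⟩ : 𝒪[K]) • (ϖ ^ (c₁ - k) * u, ϖ ^ (c₂ - k)) + (⟨s, hs⟩ : 𝒪[K]) • ((0 : K), (ϖ ^ c₂ : K)) := by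
      ext
      · change p.1 = r * (ϖ ^ (c₁ - k) * u) + s * 0
        rw [mul_zero, add_zero, hr']
      · change p.2 = r * ϖ ^ (c₂ - k) + s * ϖ ^ c₂
        rw [← hs', add_sub_cancel]
    rw [hp_eq]
    exact add_mem (Submodule.smul_mem _ _ (Submodule.subset_span (by simp)))
      (Submodule.smul_mem _ _ (Submodule.subset_span (by simp)))
  · -- `span ⊆ M`: the three generators lie in `M`
    refine SetLike.coe_subset_coe.2 (Submodule.span_le.2 ?_)
    intro x hx
    simp only [Set.mem_insert_iff, Set.mem_singleton_iff] at hx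
    rcases hx with rfl | rfl | rfl
    exacts [h₁.1, h₂.1, hstar]

end Literature.NumberTheory.Automorphic.UnitaryThreeFourFrame

end
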